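import Summits.MatrixMultiplication.MatrixMultiplication.Theorems.AbelianSTPPSieveVP

/-!
# Rule U11-GW2 of the abelian STPP census: Grynkiewicz–Wang fibred over an index-2 subgroup, with popular-set exclusion

Cell mm-stpp (rung F-M1), theory lane «past the quartet's walls» (seat mm-stpp-theory, gen 16).  A NEW necessary condition on the shape
list of an STPP family in a finite abelian group `H` of EVEN order `M = 2k`, beyond the quartet
`SieveAdmissible ∧ U11GPrime ∧ TAKnap575.E3Adm ∧ FP2.FP2Adm` (and E3K / E3KJ): it kills the first quartet-alive T_E list of record,
`(7,7,7)⁴ + (5,6,6)` at `594 = 2·297` (`AbelianSTPPCensusQuartetWitnesses.quartetHypotheses_hold_at_594`), see `…GW2Wall594.lean`.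

THE RULE (form B; forms A, C are form B of the rotated families `(C,A,B)`, `(B,C,A)`).  Notation of `AbelianSTPPSieveVP` /
`AbelianSTPPCensusVPBookkeeping`: `X = ⋃ (B_j − A_j)` (`|X| = P_AB`), `Y = ⋃ (C_k − B_k)` (`|Y| = P_BC`), `Z′ = ⋃ (C_i − A_i)`
(`|Z′| = P_CA`), `r_{X,Y} = b_i` on `C_i − A_i`, `Σ_{w ∈ Z′} r_{X,Y}(w) = S := Σ_i a_i b_i c_i`, `cap := max_i b_i`.  Let `K ≤ H` be a
subgroup of index `2` (`|K| = k`; one exists whenever `M` is even) and `x, y, z` the numbers of elements of `X, Y, Z′` in `K`.  The four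
CLASS PAIRS `(X∩K, Y∩K)`, `(X∖K, Y∖K)` (sums in `K`, target `Z′ ∩ K`, `z` points) and `(X∩K, Y∖K)`, `(X∖K, Y∩K)` (target `Z′∖K`, `P_CA − z`
points) have solution counts `n₀₀ + n₁₁ ≤ cap·z`, `n₀₁ + n₁₀ ≤ cap·(P_CA − z)`, `Σ n = S`, and each class `(U, V) → T` (sizes `u, v, w`,
inside cosets of size `k`) satisfies (`GW2.ClassOK`): `n ≤ uv`, `n ≤ w·min(u,v)`, the pigeonhole floor `w·(u + v − k) ≤ n`, and for every
`cap < t ≤ min(u,v)` the Grynkiewicz–Wang dichotomy (tree KERNEL theorem `GrynkiewiczWang.grynkiewiczWang2026_thm_1_8`): EITHER the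
floor `t(u + v + w) ≤ n + tk + ⌊(4t² − 2t)/3⌋`, OR the structural branch, whose `t`-popular set `S_t = U′ + V′` is periodic with a period
group of some order `h ≥ 2`, `h ∣ k`; since `t > cap ≥ r_{X,Y}` on `Z′`, `S_t` MISSES `Z′`, so `h·⌈max(u − t + 1, v − t + 1, u + v − h − t + 1, 1)/h⌉
≤ |S_t| ≤ k − w` (Kneser's bound `|U′ + V′| ≥ |U′| + |V′| − h`, tree `card_add_card_le_card_add_add_card_addStab`), and the printed
stabiliser bound gives `t(u + v + w) ≤ n + t(k + h)`.  `GW2Adm M a b c`: IF `M = 2k` THEN some `(x, y, z)` passes all three letter forms.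
Soundness (`IsSTPP ⇒ GW2Adm`) is `AbelianSTPPCensusGW2Sound.lean`; this file has the definitions and the Boolean box-bisection checker
`GW2.check` (monotone corner bounds on boxes of the split cube `(x, y, z)`; its soundness is `AbelianSTPPCensusGW2Check.lean`).
Exact Python twin: seat folder `calc/fq/gw2lean_twin.py` (594: `check = true`, 663 certified boxes, 1 325 nodes, fuel 40).
WHY IT BITES (numbers, seat memo HOME/mm-stpp-theory/GW2-NOTE.md): fibring U11-G′ over an index-2 subgroup keeps the linear term `+2t/3` of
the GW constant once per class (gain ≈ `2t/3` over the global rule: `1564 > 1552 = S` at 594 where U11-G′ gives `1542`), and the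
structural branch is excluded by SIZE because `k = 297` has no divisor in `(k/3, k)`; at `M ≡ 0 (mod 4)` the branch `h = k/2` is
size-feasible and the rule is usually silent.
WHAT THIS IS NOT: no claim here (definitions only); no `ω` statement; no census number.
-/

set_option linter.dupNamespace false -- `MatrixMultiplication.MatrixMultiplication` (summit = problem, D-0017)
set_option autoImplicit false

namespace Summit.MatrixMultiplication.MatrixMultiplication.Theorems

open Finset

namespace GW2

/-! ### The shape-level predicate -/

/-- The Grynkiewicz–Wang 2026 constant `⌊(4t² − 2t)/3⌋` of Theorem 1.8 (tree `PollardFourThirds`). [bookkeeping] -/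
def cgw (t : ℕ) : ℕ := (4 * t * t - 2 * t) / 3

/-- Least possible size of the `t`-popular periodic set of the structural branch with period group of order `h`, for a class pair of sizes
`u, v`: `h·⌈max(max(u, v, u + v − h) + 1 − t, 1)/h⌉` (a positive multiple of `h` that is at least `|U′|`, `|V′|` and `|U′| + |V′| − h`,
`|U′| ≥ u − t + 1`, `|V′| ≥ v − t + 1`). [bookkeeping] -/
def sizeLB (u v h t : ℕ) : ℕ := h * ((max (max (max u v) (u + v - h) + 1 - t) 1 + h - 1) / h)

/-- One class pair `(U, V) → T` of sizes `u, v, w` inside cosets of size `k` of the index-2 subgroup, `n` = number of pairs `(x, y) ∈ U × V`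
with `x + y ∈ T`, `cap` ≥ every `r_{X,Y}`-value on `T`: the two ceilings, the pigeonhole floor, and for every `cap < t ≤ min(u, v)` the
Grynkiewicz–Wang floor or a size-feasible structural branch (shape-level predicate, no claim). [original] -/
def ClassOK (k cap u v w n : ℕ) : Prop :=
  n ≤ u * v ∧ n ≤ w * min u v ∧ w * (u + v - k) ≤ n ∧
  ∀ t : ℕ, cap < t → t ≤ u → t ≤ v →
    t * (u + v + w) ≤ n + t * k + cgw t ∨
    ∃ h : ℕ, 2 ≤ h ∧ h ∣ k ∧ sizeLB u v h t ≤ k - w ∧ t * (u + v + w) ≤ n + t * (k + h)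

/-- One letter form `U + V → W′` (totals `U, V, W`, solution total `S`, values `≤ cap` on `W′`) with `p, q, r` elements of the three sets in the
index-2 subgroup (cosets of size `k`): class bounds and the four class pairs `(p,q) → r`, `(U−p, V−q) → r`, `(p, V−q) → W−r`,
`(U−p, q) → W−r` with their budgets (shape-level predicate, no claim). [original] -/
def FormOK (k U V W S cap p q r : ℕ) : Prop :=
  p ≤ U ∧ q ≤ V ∧ r ≤ W ∧ p ≤ k ∧ U - p ≤ k ∧ q ≤ k ∧ V - q ≤ k ∧ r ≤ k ∧ W - r ≤ k ∧
  ∃ n₀₀ n₁₁ n₀₁ n₁₀ : ℕ,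
    n₀₀ + n₁₁ ≤ cap * r ∧ n₀₁ + n₁₀ ≤ cap * (W - r) ∧ n₀₀ + n₁₁ + n₀₁ + n₁₀ = S ∧
    ClassOK k cap p q r n₀₀ ∧ ClassOK k cap (U - p) (V - q) r n₁₁ ∧
    ClassOK k cap p (V - q) (W - r) n₀₁ ∧ ClassOK k cap (U - p) q (W - r) n₁₀

variable {N : ℕ}

/-- `S = Σ_i a_i b_i c_i`, the total number of solutions `x + y ∈ Z′` (`= Σ_{w ∈ Z′} r_{X,Y}(w)`). [bookkeeping] -/
def sV (a b c : Fin N → ℕ) : ℕ := ∑ i, a i * b i * c i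

/-- **Rule U11-GW2 (index-2 fibred Grynkiewicz–Wang with popular-set exclusion), shape form.**  At an even order `M = 2k` there are
subgroup counts `x, y, z` of `X = ⋃(B − A)`, `Y = ⋃(C − B)`, `Z′ = ⋃(C − A)` in an index-2 subgroup passing form B (`X, Y → Z′`, values `b`),
form A (`−Z′, X → −Y`, values `a`; rotated family `(C, A, B)`) and form C (`Y, −Z′ → −X`, values `c`; rotated family `(B, C, A)`).  Vacuous at
odd `M`.  The shape data of every `IsSTPP` family with non-empty sets in a finite abelian group of order `M` satisfies it
(`GW2.gw2Adm_of_isSTPP`, file `AbelianSTPPCensusGW2Sound`).  No claim by itself. [original] -/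
def GW2Adm (M : ℕ) (a b c : Fin N → ℕ) : Prop :=
  ∀ k : ℕ, M = 2 * k →
    ∃ x y z : ℕ,
      FormOK k (pAB a b c) (pBC a b c) (pCA a b c) (sV a b c) (univ.sup b) x y z ∧
      FormOK k (pCA a b c) (pAB a b c) (pBC a b c) (sV a b c) (univ.sup a) z x y ∧
      FormOK k (pBC a b c) (pCA a b c) (pAB a b c) (sV a b c) (univ.sup c) y z x

/-! ### The kernel checker (Boolean; soundness in `AbelianSTPPCensusGW2Check.lean`) -/

/-- Is the structural branch with period order `h` excluded at `t` for the class `(u, v) → w`?  (`k − w < sizeLB u v h t`;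
checker-internal.) [bookkeeping] -/
def exclH (k u v w t h : ℕ) : Bool := decide (k - w < sizeLB u v h t)

/-- Are all structural branches with period orders from the list `ds` excluded at `t`? (checker-internal) [bookkeeping] -/
def exclAll (k u v w t : ℕ) (ds : List ℕ) : Bool := ds.all fun h => exclH k u v w t h

/-- The largest `t` at which the branch of period order `h ≤ k − w` is still excluded, `max(u, v, u + v − h) − h·⌊(k − w)/h⌋`
(heuristic used to choose `t`; never trusted — the choice is re-verified by `exclAll`; checker-internal). [bookkeeping] -/
def tCapH (k u v w h : ℕ) : ℕ := (max (max u v) (u + v - h) + 1) - h * ((k - w) / h) - 1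

/-- The parameter `t` tried for the class `(u, v) → w`: the maximiser `⌊(3e + 2)/8⌋` of `t·e − ⌊(4t² − 2t)/3⌋` (`e = u + v + w − k`), capped by
`min(u, v)` and by the exclusion caps `tCapH` of the period orders `h ≤ k − w`, and at least `cap + 1` (checker-internal). [bookkeeping] -/
def tSel (k cap u v w : ℕ) (ds : List ℕ) : ℕ :=
  let e := u + v + w - k
  let t₀ := min ((3 * e + 2) / 8) (min u v)
  let t₁ := ds.foldr (fun h s => if h ≤ k - w then min s (tCapH k u v w h) else s) t₀
  max t₁ (cap + 1)

/-- The certified lower bound for the class count `n` of `(u, v) → w`: the pigeonhole floor `w·(u + v − k)`, or the Grynkiewicz–Wang floor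
`t(u + v + w) − tk − ⌊(4t² − 2t)/3⌋` at `t = tSel` when `cap < t ≤ min(u, v)` and every branch `h ∈ ds` is excluded (checker-internal). [bookkeeping] -/
def lval (k cap u v w : ℕ) (ds : List ℕ) : ℕ :=
  let t := tSel k cap u v w ds
  let fl := if cap < t ∧ t ≤ u ∧ t ≤ v ∧ exclAll k u v w t ds = true then t * (u + v + w) - (t * k + cgw t) else 0
  max (w * (u + v - k)) fl

/-- Is the letter form `FormOK k U V W S cap p q r` refuted for EVERY `(p, q, r)` of the box `[pl, pu] × [ql, qu] × [rl, ru]` by a monotone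
corner bound: budget of the target part in the subgroup, of the other part, the total, or the mass ceiling? (checker-internal) [bookkeeping] -/
def formKilled (k U V W S cap : ℕ) (ds : List ℕ) (pl pu ql qu rl ru : ℕ) : Bool :=
  let a := lval k cap pl ql rl ds + lval k cap (U - pu) (V - qu) rl ds
  let b := lval k cap pl (V - qu) (W - ru) ds + lval k cap (U - pu) ql (W - ru) ds
  let ub := min (pu * qu) (ru * min pu qu) + min ((U - pl) * (V - ql)) (ru * min (U - pl) (V - ql)) +
    min (pu * (V - ql)) ((W - rl) * min pu (V - ql)) + min ((U - pl) * qu) ((W - rl) * min (U - pl) qu)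
  decide (cap * ru < a) || decide (cap * (W - rl) < b) || decide (S < a + b) || decide (ub < S)

/-- Is every split `(x, y, z)` of the box `[xl, xu] × [yl, yu] × [zl, zu]` refuted by form B, form A or form C?  (`X, Y, Z` = `P_AB, P_BC, P_CA`;
`ca, cb, cc` = the largest `a`, `b`, `c`; checker-internal.) [bookkeeping] -/
def boxKilled (k X Y Z S ca cb cc : ℕ) (ds : List ℕ) (xl xu yl yu zl zu : ℕ) : Bool :=
  formKilled k X Y Z S cb ds xl xu yl yu zl zu || formKilled k Z X Y S ca ds zl zu xl xu yl yu ||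
    formKilled k Y Z X S cc ds yl yu zl zu xl xu

/-- Box bisection with fuel: a box is certified if `boxKilled`, else it is cut in two halves along its longest side and both halves are
certified with one unit of fuel less (checker-internal). [bookkeeping] -/
def certify (k X Y Z S ca cb cc : ℕ) (ds : List ℕ) : ℕ → ℕ → ℕ → ℕ → ℕ → ℕ → ℕ → Bool
  | 0, xl, xu, yl, yu, zl, zu => boxKilled k X Y Z S ca cb cc ds xl xu yl yu zl zu
  | fuel + 1, xl, xu, yl, yu, zl, zu =>
    boxKilled k X Y Z S ca cb cc ds xl xu yl yu zl zu ||
      (if yu - yl ≤ xu - xl ∧ zu - zl ≤ xu - xl then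
        decide (xl < xu) && certify k X Y Z S ca cb cc ds fuel xl ((xl + xu) / 2) yl yu zl zu &&
          certify k X Y Z S ca cb cc ds fuel ((xl + xu) / 2 + 1) xu yl yu zl zu
      else if zu - zl ≤ yu - yl then
        decide (yl < yu) && certify k X Y Z S ca cb cc ds fuel xl xu yl ((yl + yu) / 2) zl zu &&
          certify k X Y Z S ca cb cc ds fuel xl xu ((yl + yu) / 2 + 1) yu zl zu
      else
        decide (zl < zu) && certify k X Y Z S ca cb cc ds fuel xl xu yl yu zl ((zl + zu) / 2) &&
          certify k X Y Z S ca cb cc ds fuel xl xu yl yu ((zl + zu) / 2 + 1) zu)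

/-- Does the list `ds` contain every divisor `h ≥ 2` of `k`? (checked once; checker-internal) [bookkeeping] -/
def divsOK (k : ℕ) (ds : List ℕ) : Bool :=
  (List.range (k + 1)).all fun h => decide (h < 2) || !decide (h ∣ k) || decide (h ∈ ds)

/-- **The checker.**  `check k X Y Z S ca cb cc ds fuel = true` means: `ds` lists every divisor `≥ 2` of `k`, and every split
`(x, y, z)` with `x ≤ min(X, k)`, `X − x ≤ k`, … is refuted — hence no shape list with `(P_AB, P_BC, P_CA) = (X, Y, Z)`, `Σ abc = S` and
letter maxima `(ca, cb, cc)` is `GW2Adm (2k)` (`GW2.not_gw2Adm_of_check`, file `AbelianSTPPCensusGW2Check`). [bookkeeping] -/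
def check (k X Y Z S ca cb cc : ℕ) (ds : List ℕ) (fuel : ℕ) : Bool :=
  divsOK k ds && certify k X Y Z S ca cb cc ds fuel (X - k) (min X k) (Y - k) (min Y k) (Z - k) (min Z k)

/-! ### Sanity (kernel evaluation on toy data) -/

/-- The class bound at the uniform split of the 594 list: `lval 297 7 113 115 113 = 374` (`t = 16`, all seven branches excluded). [bookkeeping] -/
example : lval 297 7 113 115 113 [3, 9, 11, 27, 33, 99, 297] = 374 := by decide

/-- A degenerate split (everything outside the subgroup) is refuted by the mass ceiling of form B. [bookkeeping] -/
example : formKilled 297 226 232 226 1552 7 [3, 9, 11, 27, 33, 99, 297] 0 0 0 0 0 0 = true := by decide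

end GW2

end Summit.MatrixMultiplication.MatrixMultiplication.Theorems
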